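import Summits.SmoothPoincare4.SmoothPoincare4.Theorems.ConvexBisectionAcyclicBisectionExistsPrimitiveOrbit
import HarnessLib

/-!
# `e_{j+1}` is reached from `e_j` by chain transvections and transvections along `e_{j−1}`, `e_j`
# (wave 6, brick G6-10 of node N3a `node_STcurve` of stub `stub_STgeo` = NF4 N3, line `modp-braid-orbits`,
# crux `ConvexBisection.AcyclicBisectionExists`, item stmt-SmoothPoincare4-10508; registered sub-goal
# `helper_orbit_single_succ`)

Purpose: shrink the one remaining geometric input of N3a (charted page curves of class `±e_j` for ALL
`1 ≤ j < g`, `helper_node_STcurve_of_eCurves`) to the SINGLE class `±e_1` (Humphries' generator).  On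
shadows a page Dehn twist package for a class `c` conjugates a package for `a` into one for
`T_c^{±} a` (the sequel `…StabilisationCurvesOneCurve.lean`), so packages for all `e_j` follow from
packages for the chain classes and for `e_1` once

  **`−e_{j+1}` lies in the orbit of `e_j` under the signed transvections along the chain vectors and
  along `e_{j'}`, `j' ≤ j`** (`orbit_single_succ`, registered `helper_orbit_single_succ`; `1 ≤ j`,
  `j + 2 ≤ g`),

proved by an explicit word of sixteen positive transvections (found by breadth-first search; it uses
the three pairs `j−1, j, j+1`: along `f_j, e_j − e_{j−1}, f_{j−1}, e_{j−1}, e_{j+1} − e_j, f_j, f_{j+1},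
e_j − e_{j−1}, f_{j−1}, e_{j+1} − e_j, f_j, e_j, e_j − e_{j−1}, f_j, e_{j+1} − e_j, f_{j+1}`), verified
symbolically on six-term vectors `vec6`.  (No shorter word exists with these generators and entries
bounded by `3`; with the pairs `j, j+1` alone there is none.)  One definition (`vec6`, the six-term test
vectors); everything else proved; no named facts, no `sorry`.  Reference: B. Farb, D. Margalit, *A primer
on mapping class groups* (2012), §4.4 (Humphries generators) [FarbMargalit2012]. [folklore]
-/

noncomputable section

set_option linter.dupNamespace false

open Set Function
open Literature.Topology.FourManifolds Literature.Topology.FourManifolds.LefschetzBase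
  Literature.GroupTheory.CombinatorialGroupTheory.SignedHurwitz

namespace Summit.SmoothPoincare4.SmoothPoincare4.Theorems.AcyclicBisectionExists.ModpBraidOrbits

variable {g : ℕ}

/-! ## §1 Six-term test vectors on three symplectic pairs -/

/-- **Six-term vectors** `α e_i + β f_i + γ e_j + δ f_j + ε e_k + ζ f_k`. [folklore] -/
def vec6 (i j k : Fin g) (α β γ δ ε ζ : ℤ) : Fin g ⊕ Fin g → ℤ :=
  α • Pi.single (Sum.inl i) 1 + β • Pi.single (Sum.inr i) 1 + γ • Pi.single (Sum.inl j) 1 +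
    δ • Pi.single (Sum.inr j) 1 + ε • Pi.single (Sum.inl k) 1 + ζ • Pi.single (Sum.inr k) 1

section Vec

variable {i j k : Fin g}

/-- Coordinate `e_i`. [folklore] -/
theorem vec6_inl_i (hij : i ≠ j) (hik : i ≠ k) (α β γ δ ε ζ : ℤ) : vec6 i j k α β γ δ ε ζ (Sum.inl i) = α := by
  simp [vec6, hij, hik]

/-- Coordinate `f_i`. [folklore] -/
theorem vec6_inr_i (hij : i ≠ j) (hik : i ≠ k) (α β γ δ ε ζ : ℤ) : vec6 i j k α β γ δ ε ζ (Sum.inr i) = β := by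
  simp [vec6, hij, hik]

/-- Coordinate `e_j`. [folklore] -/
theorem vec6_inl_j (hij : i ≠ j) (hjk : j ≠ k) (α β γ δ ε ζ : ℤ) : vec6 i j k α β γ δ ε ζ (Sum.inl j) = γ := by
  simp [vec6, hij.symm, hjk]

/-- Coordinate `f_j`. [folklore] -/
theorem vec6_inr_j (hij : i ≠ j) (hjk : j ≠ k) (α β γ δ ε ζ : ℤ) : vec6 i j k α β γ δ ε ζ (Sum.inr j) = δ := by
  simp [vec6, hij.symm, hjk]

/-- Coordinate `e_k`. [folklore] -/
theorem vec6_inl_k (hjk : j ≠ k) (hik : i ≠ k) (α β γ δ ε ζ : ℤ) : vec6 i j k α β γ δ ε ζ (Sum.inl k) = ε := by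
  simp [vec6, hik.symm, hjk.symm]

/-- Coordinate `f_k`. [folklore] -/
theorem vec6_inr_k (hjk : j ≠ k) (hik : i ≠ k) (α β γ δ ε ζ : ℤ) : vec6 i j k α β γ δ ε ζ (Sum.inr k) = ζ := by
  simp [vec6, hik.symm, hjk.symm]

/-! ## §2 The seven transvections on six-term vectors -/

/-- `T_{e_i}^{+}`: `α ↦ α + β`. [folklore] -/
theorem T_ei (hij : i ≠ j) (hik : i ≠ k) (α β γ δ ε ζ : ℤ) : transvection (stdSymp ℤ g) (Pi.single (Sum.inl i) 1, true) (vec6 i j k α β γ δ ε ζ) =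
    vec6 i j k (α + β) β γ δ ε ζ := by
  rw [transvection_apply, stdSymp_int_single_inl, vec6_inr_i hij hik, sgn_true, one_mul]
  simp only [vec6]; module

/-- `T_{e_j}^{+}`: `γ ↦ γ + δ`. [folklore] -/
theorem T_ej (hij : i ≠ j) (hjk : j ≠ k) (α β γ δ ε ζ : ℤ) : transvection (stdSymp ℤ g) (Pi.single (Sum.inl j) 1, true) (vec6 i j k α β γ δ ε ζ) =
    vec6 i j k α β (γ + δ) δ ε ζ := by
  rw [transvection_apply, stdSymp_int_single_inl, vec6_inr_j hij hjk, sgn_true, one_mul]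
  simp only [vec6]; module

/-- `T_{f_i}^{+}`: `β ↦ β − α`. [folklore] -/
theorem T_fi (hij : i ≠ j) (hik : i ≠ k) (α β γ δ ε ζ : ℤ) : transvection (stdSymp ℤ g) (Pi.single (Sum.inr i) 1, true) (vec6 i j k α β γ δ ε ζ) =
    vec6 i j k α (β - α) γ δ ε ζ := by
  rw [transvection_apply, stdSymp_int_single_inr, vec6_inl_i hij hik, sgn_true, one_mul]
  simp only [vec6]; module

/-- `T_{f_j}^{+}`: `δ ↦ δ − γ`. [folklore] -/
theorem T_fj (hij : i ≠ j) (hjk : j ≠ k) (α β γ δ ε ζ : ℤ) : transvection (stdSymp ℤ g) (Pi.single (Sum.inr j) 1, true) (vec6 i j k α β γ δ ε ζ) =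
    vec6 i j k α β γ (δ - γ) ε ζ := by
  rw [transvection_apply, stdSymp_int_single_inr, vec6_inl_j hij hjk, sgn_true, one_mul]
  simp only [vec6]; module

/-- `T_{f_k}^{+}`: `ζ ↦ ζ − ε`. [folklore] -/
theorem T_fk (hjk : j ≠ k) (hik : i ≠ k) (α β γ δ ε ζ : ℤ) : transvection (stdSymp ℤ g) (Pi.single (Sum.inr k) 1, true) (vec6 i j k α β γ δ ε ζ) =
    vec6 i j k α β γ δ ε (ζ - ε) := by
  rw [transvection_apply, stdSymp_int_single_inr, vec6_inl_k hjk hik, sgn_true, one_mul]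
  simp only [vec6]; module

/-- `T_{e_j − e_i}^{+}`: `γ ↦ γ + (δ − β)`, `α ↦ α − (δ − β)`. [folklore] -/
theorem T_Cj (hij : i ≠ j) (hjk : j ≠ k) (hik : i ≠ k) (α β γ δ ε ζ : ℤ) : transvection (stdSymp ℤ g) (Pi.single (Sum.inl j) 1 - Pi.single (Sum.inl i) 1, true)
    (vec6 i j k α β γ δ ε ζ) = vec6 i j k (α - (δ - β)) β (γ + (δ - β)) δ ε ζ := by
  rw [transvection_apply, map_sub, LinearMap.sub_apply, stdSymp_int_single_inl, stdSymp_int_single_inl,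
    vec6_inr_j hij hjk, vec6_inr_i hij hik, sgn_true, one_mul]
  simp only [vec6]; module

/-- `T_{e_k − e_j}^{+}`: `ε ↦ ε + (ζ − δ)`, `γ ↦ γ − (ζ − δ)`. [folklore] -/
theorem T_Ck (hij : i ≠ j) (hjk : j ≠ k) (hik : i ≠ k) (α β γ δ ε ζ : ℤ) : transvection (stdSymp ℤ g) (Pi.single (Sum.inl k) 1 - Pi.single (Sum.inl j) 1, true)
    (vec6 i j k α β γ δ ε ζ) = vec6 i j k α β (γ - (ζ - δ)) δ (ε + (ζ - δ)) ζ := by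
  rw [transvection_apply, map_sub, LinearMap.sub_apply, stdSymp_int_single_inl, stdSymp_int_single_inl,
    vec6_inr_k hjk hik, vec6_inr_j hij hjk, sgn_true, one_mul]
  simp only [vec6]; module

end Vec

/-! ## §3 The orbit step `e_j ⤳ −e_{j+1}` -/

/-- `e_j` as a six-term vector. [folklore] -/
theorem vec6_ej (i j k : Fin g) : vec6 i j k 0 0 1 0 0 0 = Pi.single (Sum.inl j) 1 := by
  simp [vec6]

/-- `−e_k` as a six-term vector. [folklore] -/
theorem vec6_neg_ek (i j k : Fin g) : vec6 i j k 0 0 0 0 (-1) 0 = -Pi.single (Sum.inl k) 1 := by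
  simp [vec6]

/-- **The orbit step, for three consecutive indices `i, j, k`.**  `−e_k` is reached from `e_j` by signed
transvections along chain vectors `chainVec g m` (`m < 2g`) and along the coordinate vectors `e_{j'}`,
`j' ≤ j` — by the explicit sixteen-letter word of the module docstring. [cite: FarbMargalit2012, §4.4] -/
theorem orbit_single_succ' (i j k : Fin g) (hji : (j : ℕ) = i + 1) (hkj : (k : ℕ) = j + 1) :
    Relation.ReflTransGen (fun x y : Fin g ⊕ Fin g → ℤ =>
      ∃ (a : Fin g ⊕ Fin g → ℤ) (s : Bool), ((∃ m : ℕ, m < 2 * g ∧ a = chainVec g m) ∨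
        (∃ j' : Fin g, (j' : ℕ) ≤ j ∧ a = Pi.single (Sum.inl j') 1)) ∧ y = transvection (stdSymp ℤ g) (a, s) x)
      (Pi.single (Sum.inl j) 1) (-Pi.single (Sum.inl k) 1) := by
  have hij : i ≠ j := fun h => by have := congrArg Fin.val h; omega
  have hjk : j ≠ k := fun h => by have := congrArg Fin.val h; omega
  have hik : i ≠ k := fun h => by have := congrArg Fin.val h; omega
  have hkg := k.2
  -- the generators are allowed moves
  have hCj : (Pi.single (Sum.inl j) 1 : Fin g ⊕ Fin g → ℤ) - Pi.single (Sum.inl i) 1 = chainVec g (2 * j) := by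
    have h := chainVec_even g j
    rw [if_pos (by omega : 0 < (j : ℕ))] at h
    have hi' : (⟨(j : ℕ) - 1, by omega⟩ : Fin g) = i := Fin.ext (by simp only; omega)
    rw [hi'] at h
    exact h.symm
  have hCk : (Pi.single (Sum.inl k) 1 : Fin g ⊕ Fin g → ℤ) - Pi.single (Sum.inl j) 1 = chainVec g (2 * k) := by
    have h := chainVec_even g k
    rw [if_pos (by omega : 0 < (k : ℕ))] at h
    have hj' : (⟨(k : ℕ) - 1, by omega⟩ : Fin g) = j := Fin.ext (by simp only; omega)
    rw [hj'] at h
    exact h.symm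
  -- one move along an allowed vector
  have mv : ∀ (x : Fin g ⊕ Fin g → ℤ) (a : Fin g ⊕ Fin g → ℤ),
      ((∃ m : ℕ, m < 2 * g ∧ a = chainVec g m) ∨ (∃ j' : Fin g, (j' : ℕ) ≤ j ∧ a = Pi.single (Sum.inl j') 1)) →
      Relation.ReflTransGen (fun x y : Fin g ⊕ Fin g → ℤ =>
        ∃ (a : Fin g ⊕ Fin g → ℤ) (s : Bool), ((∃ m : ℕ, m < 2 * g ∧ a = chainVec g m) ∨
          (∃ j' : Fin g, (j' : ℕ) ≤ j ∧ a = Pi.single (Sum.inl j') 1)) ∧ y = transvection (stdSymp ℤ g) (a, s) x)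
        x (transvection (stdSymp ℤ g) (a, true) x) :=
    fun x a ha => Relation.ReflTransGen.single ⟨a, true, ha, rfl⟩
  have gfi : (∃ m : ℕ, m < 2 * g ∧ (Pi.single (Sum.inr i) 1 : Fin g ⊕ Fin g → ℤ) = chainVec g m) ∨
      (∃ j' : Fin g, (j' : ℕ) ≤ j ∧ (Pi.single (Sum.inr i) 1 : Fin g ⊕ Fin g → ℤ) = Pi.single (Sum.inl j') 1) :=
    Or.inl ⟨2 * i + 1, by omega, (chainVec_odd g i).symm⟩
  have gfj : (∃ m : ℕ, m < 2 * g ∧ (Pi.single (Sum.inr j) 1 : Fin g ⊕ Fin g → ℤ) = chainVec g m) ∨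
      (∃ j' : Fin g, (j' : ℕ) ≤ j ∧ (Pi.single (Sum.inr j) 1 : Fin g ⊕ Fin g → ℤ) = Pi.single (Sum.inl j') 1) :=
    Or.inl ⟨2 * j + 1, by omega, (chainVec_odd g j).symm⟩
  have gfk : (∃ m : ℕ, m < 2 * g ∧ (Pi.single (Sum.inr k) 1 : Fin g ⊕ Fin g → ℤ) = chainVec g m) ∨
      (∃ j' : Fin g, (j' : ℕ) ≤ j ∧ (Pi.single (Sum.inr k) 1 : Fin g ⊕ Fin g → ℤ) = Pi.single (Sum.inl j') 1) :=
    Or.inl ⟨2 * k + 1, by omega, (chainVec_odd g k).symm⟩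
  have gCj : (∃ m : ℕ, m < 2 * g ∧ ((Pi.single (Sum.inl j) 1 : Fin g ⊕ Fin g → ℤ) - Pi.single (Sum.inl i) 1) = chainVec g m) ∨
      (∃ j' : Fin g, (j' : ℕ) ≤ j ∧ ((Pi.single (Sum.inl j) 1 : Fin g ⊕ Fin g → ℤ) - Pi.single (Sum.inl i) 1) =
        Pi.single (Sum.inl j') 1) := Or.inl ⟨_, by omega, hCj⟩
  have gCk : (∃ m : ℕ, m < 2 * g ∧ ((Pi.single (Sum.inl k) 1 : Fin g ⊕ Fin g → ℤ) - Pi.single (Sum.inl j) 1) = chainVec g m) ∨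
      (∃ j' : Fin g, (j' : ℕ) ≤ j ∧ ((Pi.single (Sum.inl k) 1 : Fin g ⊕ Fin g → ℤ) - Pi.single (Sum.inl j) 1) =
        Pi.single (Sum.inl j') 1) := Or.inl ⟨_, by omega, hCk⟩
  have gei : (∃ m : ℕ, m < 2 * g ∧ (Pi.single (Sum.inl i) 1 : Fin g ⊕ Fin g → ℤ) = chainVec g m) ∨
      (∃ j' : Fin g, (j' : ℕ) ≤ j ∧ (Pi.single (Sum.inl i) 1 : Fin g ⊕ Fin g → ℤ) = Pi.single (Sum.inl j') 1) :=
    Or.inr ⟨i, by omega, rfl⟩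
  have gej : (∃ m : ℕ, m < 2 * g ∧ (Pi.single (Sum.inl j) 1 : Fin g ⊕ Fin g → ℤ) = chainVec g m) ∨
      (∃ j' : Fin g, (j' : ℕ) ≤ j ∧ (Pi.single (Sum.inl j) 1 : Fin g ⊕ Fin g → ℤ) = Pi.single (Sum.inl j') 1) :=
    Or.inr ⟨j, le_rfl, rfl⟩
  -- the word
  rw [← vec6_ej i j k, ← vec6_neg_ek i j k]
  refine (mv _ _ gfj).trans ?_
  rw [T_fj hij hjk]
  refine (mv _ _ gCj).trans ?_
  rw [T_Cj hij hjk hik]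
  refine (mv _ _ gfi).trans ?_
  rw [T_fi hij hik]
  refine (mv _ _ gei).trans ?_
  rw [T_ei hij hik]
  refine (mv _ _ gCk).trans ?_
  rw [T_Ck hij hjk hik]
  refine (mv _ _ gfj).trans ?_
  rw [T_fj hij hjk]
  refine (mv _ _ gfk).trans ?_
  rw [T_fk hjk hik]
  refine (mv _ _ gCj).trans ?_
  rw [T_Cj hij hjk hik]
  refine (mv _ _ gfi).trans ?_
  rw [T_fi hij hik]
  refine (mv _ _ gCk).trans ?_
  rw [T_Ck hij hjk hik]
  refine (mv _ _ gfj).trans ?_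
  rw [T_fj hij hjk]
  refine (mv _ _ gej).trans ?_
  rw [T_ej hij hjk]
  refine (mv _ _ gCj).trans ?_
  rw [T_Cj hij hjk hik]
  refine (mv _ _ gfj).trans ?_
  rw [T_fj hij hjk]
  refine (mv _ _ gCk).trans ?_
  rw [T_Ck hij hjk hik]
  refine (mv _ _ gfk).trans ?_
  rw [T_fk hjk hik]
  norm_num
  exact Relation.ReflTransGen.refl

/-- **The orbit step.**  For `1 ≤ j` and `j + 2 ≤ g`, `−e_{j+1}` is reached from `e_j` by signed
transvections along chain vectors and along `e_{j'}`, `j' ≤ j`. [cite: FarbMargalit2012, §4.4] -/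
theorem orbit_single_succ {j : ℕ} (hj1 : 1 ≤ j) (hj2 : j + 2 ≤ g) :
    Relation.ReflTransGen (fun x y : Fin g ⊕ Fin g → ℤ =>
      ∃ (a : Fin g ⊕ Fin g → ℤ) (s : Bool), ((∃ m : ℕ, m < 2 * g ∧ a = chainVec g m) ∨
        (∃ j' : Fin g, (j' : ℕ) ≤ j ∧ a = Pi.single (Sum.inl j') 1)) ∧ y = transvection (stdSymp ℤ g) (a, s) x)
      (Pi.single (Sum.inl (⟨j, by omega⟩ : Fin g)) 1) (-Pi.single (Sum.inl (⟨j + 1, by omega⟩ : Fin g)) 1) :=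
  orbit_single_succ' ⟨j - 1, by omega⟩ ⟨j, by omega⟩ ⟨j + 1, by omega⟩ (by simp only; omega) rfl

/-! ## The registered form -/

/-- **Sub-goal `helper_orbit_single_succ`** (G6-10, algebra for the one-curve reduction of node N3a):
for `1 ≤ j`, `j + 2 ≤ g`, `−e_{j+1}` is reached from `e_j` by finitely many signed transvections
(`stdSymp ℤ g`) along chain vectors `chainVec g m` (`m < 2g`) and coordinate vectors `e_{j'}` with
`j' ≤ j`. [cite: FarbMargalit2012, §4.4] -/
theorem helper_orbit_single_succ : ∀ (g j : ℕ) (hj1 : 1 ≤ j) (hj2 : j + 2 ≤ g), Relation.ReflTransGen (fun x y : Fin g ⊕ Fin g → ℤ => ∃ (a : Fin g ⊕ Fin g → ℤ) (s : Bool), ((∃ m : ℕ, m < 2 * g ∧ a = Literature.Topology.FourManifolds.LefschetzBase.chainVec g m) ∨ (∃ j' : Fin g, (j' : ℕ) ≤ j ∧ a = Pi.single (Sum.inl j') 1)) ∧ y = Literature.GroupTheory.CombinatorialGroupTheory.SignedHurwitz.transvection (Literature.GroupTheory.CombinatorialGroupTheory.SignedHurwitz.stdSymp ℤ g) (a, s)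 x) (Pi.single (Sum.inl (⟨j, by omega⟩ : Fin g)) 1) (-Pi.single (Sum.inl (⟨j + 1, by omega⟩ : Fin g)) 1) :=
  fun _ _ hj1 hj2 => orbit_single_succ hj1 hj2

end Summit.SmoothPoincare4.SmoothPoincare4.Theorems.AcyclicBisectionExists.ModpBraidOrbits

end
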